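import Mathlib
import HarnessLib

/-!
# Fischler's change of variables between the Beukers–Vasilyev and the Sorokin families of multiple integrals (Fischler 2002, §2)

Topic `Literature/NumberTheory/Irrationality/Fischler2002`. Typed, cited statements (named facts, no proofs,
D-0014) from S. Fischler, « Formes linéaires en polyzêtas et intégrales multiples », C. R. Acad. Sci. Paris,
Sér. I **335** (2002) 1–4 = arXiv:math/0202064 [Fischler2002Polyzetas], §2 « Une généralisation commune des
intégrales de Vasilyev et de Sorokin » (proofs: S. Fischler, *Groupes de Rhin-Viola et intégrales multiples*,
J. Théor. Nombres Bordeaux **15** (2003) 479–534 [Fischler2003RhinViola], §5). PRIMARY SOURCE read on the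
page: arXiv text `paper:arxiv-math_0202064` pp. 1–3 (formulas), and the journal proofs
`paper:url-3c064f6d9737` (JTNB scan) pp. 525–534 for the section structure. Companion of `FamilyJ.lean`
(§3 of the same note, `n = 5`). Cell zeta5-irr (HONEST FRAMING: systematic search; no irrationality claim
unless certified): this is the printed DICTIONARY between the nested-`δ` integrals of
Beukers–Vasilenko–Vasilyev (the cell's `J₅`, the tree's `Zudilin2002.sorokinIntegral`) and the
nested-PRODUCT integrals `∫ ∏X^A(1−X)^B/∏(1 − X₁⋯X_k)^{C_k+1}` of Sorokin–Rivoal, to which Zlobin's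
denominator theorem (`Zlobin2005/SorokinIntegralCoefficients.lean`) applies.

§1 [cite: Fischler2002Polyzetas, §1 p. 1]: "`B(N) = ∫_{[0,1]³} x^N(1−x)^N y^N(1−y)^N z^N(1−z)^N /
(1 − z(1−y(1−x)))^{N+1} dx dy dz`" (Beukers), "`S(N) = ∫_{[0,1]³} x^N(1−x)^N y^N(1−y)^N z^N(1−z)^N /
((1−xy)^{N+1}(1−xyz)^{N+1}) dx dy dz`" (Sorokin); "Or ces formes linéaires coïncident. Si on croit à la
philosophie des périodes [KontsevichZagier], l'égalité de ces intégrales doit pouvoir se démontrer par une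
suite de changements de variables … En l'occurrence, un seul changement de variables suffit (voir le théorème
2.1)." Vasilyev: "`δ_k(x₁,…,x_n) = 1 − x_k δ_{k−1}(x₁,…,x_n)` pour `n ≥ 2` et `k ∈ {1,…,n}` avec `δ₀ = 1`",
and the integral (1) "`∫_{[0,1]^n} ∏_{k=1}^n x_k^N(1−x_k)^N / δ_n(x₁,…,x_n)^{N+1} dx₁…dx_n`".

§2 [cite: Fischler2002Polyzetas, §2 pp. 2–3]: "Dans tout ce texte, `n` désigne un entier supérieur ou égal à 2.
Pour `k ∈ {0,…,n}` et `x = (x₁,…,x_n) ∈ [0,1]^n` on pose `δ̃_k(x) = Σ_{j=0}^{k} (−1)^j x_n x_{n−1} ⋯ x_{n−j+1}`.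
On a alors `δ̃₀(x) = 1`, `δ̃₁(x) = 1 − x_n`, `δ̃₂(x) = 1 − x_n(1−x_{n−1})` et `δ̃_n(x) = δ_n(x)`. À tout
`p = (a₁,…,a_n,b₁,…,b_n,c₂,…,c_n) ∈ ℤ^{3n−1}` on associe l'intégrale (éventuellement infinie)
`𝒦(p) = ∫_{[0,1]^n} ∏_{k=1}^n x_k^{a_k}(1−x_k)^{b_k} / ∏_{k=2}^n δ̃_k(x)^{c_k}
        · ∏_{k ∈ {2,…,n−2} pair} δ̃_k(x) / ∏_{k ∈ {3,…,n−1} impair} δ̃_k(x) · dx₁…dx_n/δ̃_n(x)`.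
Par ailleurs, à tout `P = (A₁,…,A_n,B₁,…,B_n,C₂,…,C_n) ∈ ℤ^{3n−1}` on associe
`𝓛(P) = ∫_{[0,1]^n} ∏_{k=1}^n X_k^{A_k}(1−X_k)^{B_k} / ∏_{k=2}^n (1 − X₁X₂…X_k)^{C_k+1} dX₁…dX_n`.
… **Théorème 2.1.** Pour tout `p ∈ ℤ^{3n−1}` on a `𝒦(p) = 𝓛(P)`, où `P` est donné en fonction de `p` par :
`A_k = a_{n+1−k}` pour `1 ≤ k ≤ n` ; `B_k = b_{n+1−k}` pour `2 ≤ k ≤ n` et `B₁ = a_{n−1} + b_n − c₂ − c₃ − … − c_n` ;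
`C_k = a_{n+1−k} + b_{n+1−k} − c_k − c_{k+1} − … − c_n` pour tout `k ∈ {2,…,n}` pair ;
`C_k = c_k + c_{k+1} + … + c_n − a_{n−k}` pour tout `k ∈ {3,…,n}` impair, avec la convention `a₀ = 0`.
Ce résultat provient du changement de variables défini par `x_k = X_{n+1−k}` pour `k ≡ n mod 2` et
`x_k = (1 − X₁…X_{n−k})X_{n+1−k}/(1 − X₁…X_{n+1−k})` pour `k ≢ n mod 2`." "**Corollaire 2.2.** Avec les
notations de l'introduction, on a `B(N) = S(N)` pour tout `N ≥ 0`, et l'intégrale (1) est égale à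
`∫_{[0,1]^n} ∏ X_k^N(1−X_k)^N / ∏_{k ∈ {2,…,n} pair} (1 − X₁…X_k)^{N+1} dX` si `n` est pair,
`∫_{[0,1]^n} ∏ X_k^N(1−X_k)^N / ((1 − X₁…X_n)^{N+1} ∏_{k ∈ {2,…,n} pair} (1 − X₁…X_k)^{N+1}) dX` si `n`
est impair."

RENDERING (tree vocabulary; no notion re-declared).
* The families take values in `ℝ₊ ∪ {∞}` ("intégrale éventuellement infinie", Déf. 1.1 of the note): they
  are typed as LOWER LEBESGUE INTEGRALS `∫⁻ … ∂volume` over the closed cube of `ENNReal.ofReal` of the real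
  integrand — the integrands are products of INTEGER powers (`zpow`; `p ∈ ℤ^{3n−1}`) of quantities lying in
  `(0,1)` on the open cube (`x_k`, `1 − x_k`, `δ̃_k(x)`, `1 − X₁⋯X_k`), hence positive there; the boundary
  (where `zpow` takes junk values) is a null set. So `𝒦(p) = 𝓛(P)` is typed as an equality in `ℝ≥0∞`,
  finite or not, exactly as printed.
* Coordinates `x : Fin n → ℝ`, `x_k = coord x k` (1-based, `0` outside `1..n`); parameters as functions
  `a b c : ℕ → ℤ` read at the printed indices (`c` at `2..n`), bundled in `Exponents`; the same record type
  carries `(A, B, C)`. The index ranges `{2,…,n−2}` (even) and `{3,…,n−1}` (odd) of the two auxiliary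
  products are the printed ones (arXiv source macros `\deuxnmd`, `\troisnmu`); for `n = 3` both are empty
  and `𝒦(a,b;0,N)` with `a_k = b_k = N` is `B(N)`, mapped by Théorème 2.1 to `S(N)` (checked symbolically
  for `n = 2` and numerically for `n = 3` by the filing seat — a transcription check, not a certificate).
* `B(N)` is Fischler's form of Beukers' integral (denominator `1 − z(1−y(1−x))`); the tree's
  `Transcendental.Beukers…tripleIntegral N` has Beukers' original `1 − (1−xy)z`, which is `B(N)` after
  `x ↦ 1 − x` (not restated here).
NOT typed: the convergence criterion for `𝓛` printed in the note (`Σ_{k=2}^n (C_k − B_k)⁺ ≤ B₁`, `A_k, B_k ≥ 0`)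
— the journal version [Fischler2003RhinViola, §5.2 Prop. 16, footnote 3: « Noter l'erreur, à ce propos, dans
[6] »] CORRECTS it, and the corrected formula is not legible in the held scan; Proposition 2.3 (a Rhin–Viola
group of order 32 for `𝓛`, whose generators are only described in the note).
-/

noncomputable section

open MeasureTheory Set Finset
open scoped ENNReal

namespace Literature.NumberTheory.Irrationality.Fischler2002

/-! ### Coordinates and exponents -/

/-- The `k`-th coordinate `x_k` of `x ∈ [0,1]^n` (1-based; `0` for `k ∉ {1,…,n}`).
[cite: Fischler2002Polyzetas, §2 p. 2 (notation x = (x₁,…,x_n))] -/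
def coord {n : ℕ} (x : Fin n → ℝ) (k : ℕ) : ℝ :=
  if h : 1 ≤ k ∧ k ≤ n then x ⟨k - 1, by omega⟩ else 0

/-- The closed unit cube `[0,1]^n`. [folklore] -/
def unitCube (n : ℕ) : Set (Fin n → ℝ) := Set.pi Set.univ fun _ : Fin n => Set.Icc (0 : ℝ) 1

/-- An exponent vector `p = (a₁,…,a_n, b₁,…,b_n, c₂,…,c_n) ∈ ℤ^{3n−1}` (resp. `P = (A, B, C)`), as three
functions read at the printed indices (values elsewhere are ignored). [cite: Fischler2002Polyzetas, §2 p. 2] -/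
structure Exponents where
  /-- `a₁,…,a_n` (resp. `A₁,…,A_n`) -/
  a : ℕ → ℤ
  /-- `b₁,…,b_n` (resp. `B₁,…,B_n`) -/
  b : ℕ → ℤ
  /-- `c₂,…,c_n` (resp. `C₂,…,C_n`) -/
  c : ℕ → ℤ

/-! ### The Beukers–Vasilyev-type family `𝒦(p)` -/

/-- Fischler's `δ̃_k(x) = Σ_{j=0}^{k} (−1)^j x_n x_{n−1} ⋯ x_{n−j+1}` (`δ̃₀ = 1`, `δ̃₁ = 1 − x_n`,
`δ̃₂ = 1 − x_n(1 − x_{n−1})`, …, `δ̃_n = δ_n`). [cite: Fischler2002Polyzetas, §2 p. 2 (definition of δ̃_k)] -/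
def deltaTilde {n : ℕ} (x : Fin n → ℝ) (k : ℕ) : ℝ :=
  ∑ j ∈ Finset.range (k + 1), (-1 : ℝ) ^ j * ∏ i ∈ Finset.range j, coord x (n - i)

/-- The integrand of `𝒦(p)`:
`∏_{k=1}^n x_k^{a_k}(1−x_k)^{b_k} / ∏_{k=2}^n δ̃_k^{c_k} · ∏_{k∈{2,…,n−2} even} δ̃_k / ∏_{k∈{3,…,n−1} odd} δ̃_k · 1/δ̃_n`
(integer powers). [cite: Fischler2002Polyzetas, §2 p. 2 (definition of 𝒦(p))] -/
def integrandK (n : ℕ) (p : Exponents) (x : Fin n → ℝ) : ℝ :=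
  (∏ k ∈ Finset.Icc 1 n, coord x k ^ p.a k * (1 - coord x k) ^ p.b k) /
      (∏ k ∈ Finset.Icc 2 n, deltaTilde x k ^ p.c k) *
    ((∏ k ∈ (Finset.Icc 2 (n - 2)).filter Even, deltaTilde x k) /
      (∏ k ∈ (Finset.Icc 3 (n - 1)).filter Odd, deltaTilde x k)) /
    deltaTilde x n

/-- `𝒦(p) ∈ ℝ₊ ∪ {∞}`: the lower Lebesgue integral of the (a.e. positive) integrand over `[0,1]^n`.
[cite: Fischler2002Polyzetas, §2 p. 2 (definition of 𝒦(p))] -/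
def K (n : ℕ) (p : Exponents) : ℝ≥0∞ := ∫⁻ x in unitCube n, ENNReal.ofReal (integrandK n p x)

/-! ### The Sorokin-type family `𝓛(P)` -/

/-- `X₁X₂⋯X_k`. [cite: Fischler2002Polyzetas, §2 p. 2 (definition of 𝓛(P))] -/
def headProduct {n : ℕ} (X : Fin n → ℝ) (k : ℕ) : ℝ := ∏ i ∈ Finset.Icc 1 k, coord X i

/-- The integrand of `𝓛(P)`: `∏_{k=1}^n X_k^{A_k}(1−X_k)^{B_k} / ∏_{k=2}^n (1 − X₁X₂⋯X_k)^{C_k+1}` (integer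
powers). [cite: Fischler2002Polyzetas, §2 p. 2 (definition of 𝓛(P))] -/
def integrandL (n : ℕ) (P : Exponents) (X : Fin n → ℝ) : ℝ :=
  (∏ k ∈ Finset.Icc 1 n, coord X k ^ P.a k * (1 - coord X k) ^ P.b k) /
    ∏ k ∈ Finset.Icc 2 n, (1 - headProduct X k) ^ (P.c k + 1)

/-- `𝓛(P) ∈ ℝ₊ ∪ {∞}`. [cite: Fischler2002Polyzetas, §2 p. 2 (definition of 𝓛(P))] -/
def L (n : ℕ) (P : Exponents) : ℝ≥0∞ := ∫⁻ X in unitCube n, ENNReal.ofReal (integrandL n P X)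

/-! ### Théorème 2.1: the change of variables `𝒦(p) = 𝓛(P)` -/

/-- The parameter map `p ↦ P` of Théorème 2.1: `A_k = a_{n+1−k}` (`1 ≤ k ≤ n`); `B_k = b_{n+1−k}` (`2 ≤ k ≤ n`),
`B₁ = a_{n−1} + b_n − c₂ − ⋯ − c_n`; `C_k = a_{n+1−k} + b_{n+1−k} − c_k − c_{k+1} − ⋯ − c_n` (`k` even),
`C_k = c_k + ⋯ + c_n − a_{n−k}` (`k` odd, `3 ≤ k ≤ n`), with `a₀ = 0`.
[cite: Fischler2002Polyzetas, §2 Théorème 2.1] -/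
def paramMap (n : ℕ) (p : Exponents) : Exponents where
  a := fun k => p.a (n + 1 - k)
  b := fun k => if k = 1 then p.a (n - 1) + p.b n - ∑ j ∈ Finset.Icc 2 n, p.c j else p.b (n + 1 - k)
  c := fun k =>
    if Even k then p.a (n + 1 - k) + p.b (n + 1 - k) - ∑ j ∈ Finset.Icc k n, p.c j
    else (∑ j ∈ Finset.Icc k n, p.c j) - (if k = n then 0 else p.a (n - k))

/-- **Fischler 2002, Théorème 2.1** (named fact, statement only; a THEOREM in print, proved by one change of
variables `x_k = X_{n+1−k}` (`k ≡ n mod 2`), `x_k = (1 − X₁⋯X_{n−k})X_{n+1−k}/(1 − X₁⋯X_{n+1−k})`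
(`k ≢ n mod 2`); details in [Fischler2003RhinViola, §5]): for every `n ≥ 2` and every `p ∈ ℤ^{3n−1}`,
`𝒦(p) = 𝓛(P)` with `P = paramMap n p`, as elements of `ℝ₊ ∪ {∞}`.
[cite: Fischler2002Polyzetas, §2 Théorème 2.1] -/
def theoreme21 : Prop :=
  ∀ (n : ℕ) (p : Exponents), 2 ≤ n → K n p = L n (paramMap n p)

/-! ### Corollaire 2.2: Beukers = Sorokin, Vasilyev = Sorokin-type -/

/-- Beukers' linear forms in `1, ζ(3)` in Fischler's normalisation:
`B(N) = ∫_{[0,1]³} x^N(1−x)^N y^N(1−y)^N z^N(1−z)^N / (1 − z(1−y(1−x)))^{N+1} dx dy dz`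
(`(x,y,z) = (w 0, w 1, w 2)`; Beukers' `1 − (1−xy)z` is this after `x ↦ 1−x`).
[cite: Fischler2002Polyzetas, §1 p. 1 (definition of B(N))] -/
def beukersB (N : ℕ) : ℝ≥0∞ :=
  ∫⁻ w in unitCube 3, ENNReal.ofReal
    ((w 0) ^ N * (1 - w 0) ^ N * (w 1) ^ N * (1 - w 1) ^ N * (w 2) ^ N * (1 - w 2) ^ N /
      (1 - w 2 * (1 - w 1 * (1 - w 0))) ^ (N + 1))

/-- Sorokin's linear forms in `1, ζ(3)`:
`S(N) = ∫_{[0,1]³} x^N(1−x)^N y^N(1−y)^N z^N(1−z)^N / ((1−xy)^{N+1}(1−xyz)^{N+1}) dx dy dz`.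
[cite: Fischler2002Polyzetas, §1 p. 1 (definition of S(N))] -/
def sorokinS (N : ℕ) : ℝ≥0∞ :=
  ∫⁻ w in unitCube 3, ENNReal.ofReal
    ((w 0) ^ N * (1 - w 0) ^ N * (w 1) ^ N * (1 - w 1) ^ N * (w 2) ^ N * (1 - w 2) ^ N /
      ((1 - w 0 * w 1) ^ (N + 1) * (1 - w 0 * w 1 * w 2) ^ (N + 1)))

/-- Vasilyev's `δ_k(x₁,…,x_n) = 1 − x_k δ_{k−1}(x₁,…,x_n)`, `δ₀ = 1`.
[cite: Fischler2002Polyzetas, §1 p. 2 (definition of δ_k)] -/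
def deltaV {n : ℕ} (x : Fin n → ℝ) : ℕ → ℝ
  | 0 => 1
  | k + 1 => 1 - coord x (k + 1) * deltaV x k

/-- Vasilyev's integrals (1): `∫_{[0,1]^n} ∏_{k=1}^n x_k^N(1−x_k)^N / δ_n(x)^{N+1} dx₁…dx_n` (in `ℝ₊ ∪ {∞}`; finite
for `n ≥ 2`). [cite: Fischler2002Polyzetas, §1 eq. (1)] -/
def vasilyevIntegral (n N : ℕ) : ℝ≥0∞ :=
  ∫⁻ x in unitCube n, ENNReal.ofReal
    ((∏ k ∈ Finset.Icc 1 n, coord x k ^ N * (1 - coord x k) ^ N) / deltaV x n ^ (N + 1))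

/-- The Sorokin-type form of Vasilyev's integral given by Corollaire 2.2:
`∫ ∏ X_k^N(1−X_k)^N / ∏_{k∈{2,…,n} even} (1 − X₁…X_k)^{N+1} dX` for even `n`, and the same with the extra factor
`(1 − X₁…X_n)^{N+1}` for odd `n` — i.e. denominators over the even `k ≤ n` together with `k = n`.
[cite: Fischler2002Polyzetas, §2 Corollaire 2.2] -/
def vasilyevSorokinForm (n N : ℕ) : ℝ≥0∞ :=
  ∫⁻ X in unitCube n, ENNReal.ofReal
    ((∏ k ∈ Finset.Icc 1 n, coord X k ^ N * (1 - coord X k) ^ N) /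
      ∏ k ∈ (Finset.Icc 2 n).filter (fun k => Even k ∨ k = n), (1 - headProduct X k) ^ (N + 1))

/-- **Fischler 2002, Corollaire 2.2, first clause** (named fact, statement only; a THEOREM in print):
`B(N) = S(N)` for every `N ≥ 0` — Beukers' and Sorokin's integrals for `ζ(3)` coincide (Théorème 2.1 for
`n = 3`, `a_k = b_k = N`, `c₂ = 0`, `c₃ = N`). [cite: Fischler2002Polyzetas, §2 Corollaire 2.2] -/
def corollaire22_beukers_eq_sorokin : Prop :=
  ∀ N : ℕ, beukersB N = sorokinS N

/-- **Fischler 2002, Corollaire 2.2, second clause** (named fact, statement only; a THEOREM in print):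
for `n ≥ 2`, Vasilyev's integral (1) equals its Sorokin-type form (denominators `(1 − X₁⋯X_k)^{N+1}` over the
even `k ∈ {2,…,n}`, and also `k = n` when `n` is odd). [cite: Fischler2002Polyzetas, §2 Corollaire 2.2] -/
def corollaire22_vasilyev : Prop :=
  ∀ n N : ℕ, 2 ≤ n → vasilyevIntegral n N = vasilyevSorokinForm n N

/-! #### Corollaire 2.2 (first clause) from Théorème 2.1, checked in the tree -/

/-- The exponents of `B(N)` in the family `𝒦`: `a_k = b_k = N`, `c₂ = 0`, `c₃ = N`.
[cite: Fischler2002Polyzetas, §2 Corollaire 2.2 (proof)] -/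
def beukersExponents (N : ℕ) : Exponents where
  a := fun _ => N
  b := fun _ => N
  c := fun k => if k = 3 then N else 0

/-- `∏_{k=1}^{3} f k = f 1 · f 2 · f 3` (plumbing). [folklore] -/
private theorem prod_Icc_one_three (f : ℕ → ℝ) : ∏ k ∈ Finset.Icc 1 3, f k = f 1 * (f 2 * f 3) := by
  rw [show Finset.Icc 1 3 = {1, 2, 3} by decide, Finset.prod_insert (by decide),
    Finset.prod_insert (by decide), Finset.prod_singleton]

/-- `∏_{k=2}^{3} f k = f 2 · f 3` (plumbing). [folklore] -/
private theorem prod_Icc_two_three (f : ℕ → ℝ) : ∏ k ∈ Finset.Icc 2 3, f k = f 2 * f 3 := by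
  rw [show Finset.Icc 2 3 = {2, 3} by decide, Finset.prod_insert (by decide), Finset.prod_singleton]

/-- `∏_{k=1}^{2} f k = f 1 · f 2` (plumbing). [folklore] -/
private theorem prod_Icc_one_two (f : ℕ → ℝ) : ∏ k ∈ Finset.Icc 1 2, f k = f 1 * f 2 := by
  rw [show Finset.Icc 1 2 = {1, 2} by decide, Finset.prod_insert (by decide), Finset.prod_singleton]

/-- `x₁ = w 0` on `[0,1]³` (plumbing). [folklore] -/
private theorem coord_three_one (w : Fin 3 → ℝ) : coord w 1 = w 0 := by
  simp [coord]

/-- `x₂ = w 1` on `[0,1]³` (plumbing). [folklore] -/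
private theorem coord_three_two (w : Fin 3 → ℝ) : coord w 2 = w 1 := by
  simp only [coord, show (1:ℕ) ≤ 2 ∧ 2 ≤ 3 by omega, and_self, dite_true]
  rfl

/-- `x₃ = w 2` on `[0,1]³` (plumbing). [folklore] -/
private theorem coord_three_three (w : Fin 3 → ℝ) : coord w 3 = w 2 := by
  simp only [coord, show (1:ℕ) ≤ 3 ∧ 3 ≤ 3 by omega, and_self, dite_true]
  rfl

/-- `δ̃₃ = 1 − z(1 − y(1 − x))` for `n = 3` (`(x,y,z) = (w 0, w 1, w 2)`).
[cite: Fischler2002Polyzetas, §2 p. 2 (δ̃_n = δ_n)] -/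
theorem deltaTilde_three (w : Fin 3 → ℝ) :
    deltaTilde w 3 = 1 - w 2 * (1 - w 1 * (1 - w 0)) := by
  simp only [deltaTilde, Finset.sum_range_succ, Finset.sum_range_zero, Finset.prod_range_succ,
    Finset.prod_range_zero, show 3 - 0 = 3 by rfl, show 3 - 1 = 2 by rfl, show 3 - 2 = 1 by rfl,
    coord_three_one, coord_three_two, coord_three_three]
  ring

/-- `B(N) = 𝒦(N,N,N; N,N,N; 0,N)` (the two auxiliary products are empty for `n = 3`).
[cite: Fischler2002Polyzetas, §2 Corollaire 2.2 (proof)] -/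
theorem beukersB_eq_K (N : ℕ) : beukersB N = K 3 (beukersExponents N) := by
  unfold beukersB K
  refine lintegral_congr fun w => ?_
  congr 1
  have he : (Finset.Icc 2 (3 - 2)).filter Even = ∅ := by decide
  have ho : (Finset.Icc 3 (3 - 1)).filter Odd = ∅ := by decide
  rw [integrandK, he, ho, prod_Icc_one_three, prod_Icc_two_three]
  simp only [Finset.prod_empty]
  have hc2 : (beukersExponents N).c 2 = 0 := by simp [beukersExponents]
  have hc3 : (beukersExponents N).c 3 = N := by simp [beukersExponents]
  have ha : (beukersExponents N).a = fun _ => (N : ℤ) := rfl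
  have hb : (beukersExponents N).b = fun _ => (N : ℤ) := rfl
  simp only [hc2, hc3, ha, hb, zpow_zero, one_mul, mul_one, div_one, zpow_natCast, coord_three_one,
    coord_three_two, coord_three_three, deltaTilde_three]
  rw [div_div, ← pow_succ]
  ring

/-- The parameter map sends the exponents of `B(N)` to those of `S(N)`: `A_k = B_k = N`, `C₂ = C₃ = N`.
[cite: Fischler2002Polyzetas, §2 Corollaire 2.2 (proof)] -/
theorem paramMap_beukersExponents (N : ℕ) :
    (∀ k, (paramMap 3 (beukersExponents N)).a k = N) ∧
    (∀ k ∈ Finset.Icc 1 3, (paramMap 3 (beukersExponents N)).b k = N) ∧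
    (paramMap 3 (beukersExponents N)).c 2 = N ∧ (paramMap 3 (beukersExponents N)).c 3 = N := by
  have h22 : Finset.Icc 2 3 = {2, 3} := by decide
  refine ⟨fun k => rfl, ?_, ?_, ?_⟩
  · intro k hk
    by_cases h1 : k = 1
    · subst h1
      simp [paramMap, beukersExponents, h22]
    · simp [paramMap, beukersExponents]
  · simp [paramMap, beukersExponents, h22]
  · simp [paramMap, beukersExponents, show ¬ Even 3 by decide]

/-- `𝓛(P) = S(N)` for the image exponents. [cite: Fischler2002Polyzetas, §2 Corollaire 2.2 (proof)] -/
theorem L_paramMap_beukersExponents (N : ℕ) : L 3 (paramMap 3 (beukersExponents N)) = sorokinS N := by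
  obtain ⟨hA, hB, hC2, hC3⟩ := paramMap_beukersExponents N
  unfold L sorokinS
  refine lintegral_congr fun w => ?_
  congr 1
  have hnum : ∀ k ∈ Finset.Icc 1 3,
      coord w k ^ (paramMap 3 (beukersExponents N)).a k * (1 - coord w k) ^ (paramMap 3 (beukersExponents N)).b k
        = coord w k ^ N * (1 - coord w k) ^ N := by
    intro k hk
    rw [hA k, hB k hk, zpow_natCast, zpow_natCast]
  have hp2 : headProduct w 2 = w 0 * w 1 := by
    rw [headProduct, prod_Icc_one_two, coord_three_one, coord_three_two]
  have hp3 : headProduct w 3 = w 0 * w 1 * w 2 := by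
    rw [headProduct, prod_Icc_one_three, coord_three_one, coord_three_two, coord_three_three, mul_assoc]
  have hz : ((N : ℤ) + 1) = ((N + 1 : ℕ) : ℤ) := by push_cast; ring
  rw [integrandL, Finset.prod_congr rfl hnum, prod_Icc_one_three, prod_Icc_two_three, hC2, hC3, hp2, hp3, hz,
    zpow_natCast, zpow_natCast, coord_three_one, coord_three_two, coord_three_three]
  ring

/-- **Corollaire 2.2 (first clause) follows from Théorème 2.1**, as in the note: `B(N) = S(N)`.
[cite: Fischler2002Polyzetas, §2 Corollaire 2.2] -/
theorem corollaire22_beukers_eq_sorokin_of_theoreme21 (h : theoreme21) : corollaire22_beukers_eq_sorokin := by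
  intro N
  rw [beukersB_eq_K, h 3 (beukersExponents N) (by norm_num), L_paramMap_beukersExponents]

end Literature.NumberTheory.Irrationality.Fischler2002
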